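import Mathlib
import HarnessLib

/-!
# Route JensenLogBand, BAND crux (stmt-RiemannHypothesis-19913) — infrastructure (S4)(i):
# the cosine-descent comparison lemma (RH-FREE, pure real analysis)

Cell rh-jensen, LADDER-RH rung J-P(P3) «log band»; step (S4)(i) «global descent» of the BAND lead's
LINE-PLAN wants `log‖I(φ)‖ − log‖I(φ₀)‖ ≤ −κ₁(n+1)(1 − cos(φ−φ₀))` on `[−π/2, π/2]` from a pointwise
bound on the φ-derivative (tree `hasDerivAt_log_norm_arcModelIntegrand`, p487066). The comparison
step is generic: if `g` is differentiable on `[a,b] ∋ t₀` with `g′(t) ≤ −A sin(t−t₀)` to the right of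
`t₀` and `g′(t) ≥ −A sin(t−t₀)` to the left, then `g(t) − g(t₀) ≤ −A(1 − cos(t−t₀))` on `[a,b]`
(`G = g − g(t₀) + A(1−cos(·−t₀))` is monotone on each side of `t₀`, Mathlib
`antitoneOn_of_hasDerivWithinAt_nonpos` / `monotoneOn_of_hasDerivWithinAt_nonneg`).

WHAT THIS IS NOT: elementary calculus; nothing here bears on zeros of `ζ` or the truth of RH.
(prover-rh-jensen-eng-2-g5-0, 2026-08-27.)
-/

noncomputable section

open Set

set_option linter.dupNamespace false

namespace Summit.RiemannHypothesis.RiemannHypothesis.Theorems.JensenPolynomials.LogBandArc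

/-- **Cosine-descent comparison, right side:** on `[t₀, b]`, if `g′(t) ≤ −A·sin(t − t₀)` then
`g t − g t₀ ≤ −A(1 − cos(t − t₀))`. RH-FREE. -/
theorem sub_le_neg_mul_one_sub_cos_right {g g' : ℝ → ℝ} {t₀ b A : ℝ}
    (hg : ∀ t ∈ Icc t₀ b, HasDerivAt g (g' t) t)
    (hbound : ∀ t ∈ Icc t₀ b, g' t ≤ -A * Real.sin (t - t₀)) {t : ℝ} (ht : t ∈ Icc t₀ b) :
    g t - g t₀ ≤ -A * (1 - Real.cos (t - t₀)) := by
  set G : ℝ → ℝ := fun s => g s + A * (1 - Real.cos (s - t₀)) with hG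
  have hGd : ∀ s ∈ Icc t₀ b, HasDerivAt G (g' s + A * Real.sin (s - t₀)) s := by
    intro s hs
    have hc : HasDerivAt (fun s : ℝ => A * (1 - Real.cos (s - t₀))) (A * Real.sin (s - t₀)) s := by
      have h1 : HasDerivAt (fun s : ℝ => Real.cos (s - t₀)) (-Real.sin (s - t₀) * 1) s :=
        ((hasDerivAt_id s).sub_const t₀).cos
      have h2 := (h1.const_sub (1 : ℝ)).const_mul A
      refine h2.congr_deriv ?_
      ring
    exact (hg s hs).add hc
  have hanti : AntitoneOn G (Icc t₀ b) := by
    refine antitoneOn_of_deriv_nonpos (convex_Icc t₀ b)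
      (fun s hs => (hGd s hs).continuousAt.continuousWithinAt)
      (fun s hs => (hGd s (interior_subset hs)).differentiableAt.differentiableWithinAt) ?_
    intro s hs
    have hs' : s ∈ Icc t₀ b := interior_subset hs
    rw [(hGd s hs').deriv]
    have := hbound s hs'
    linarith
  have ht₀ : t₀ ∈ Icc t₀ b := ⟨le_rfl, ht.1.trans ht.2⟩
  have h := hanti ht₀ ht ht.1
  simp only [hG, sub_self, Real.cos_zero, mul_zero, add_zero] at h
  linarith

/-- **Cosine-descent comparison, left side:** on `[a, t₀]`, if `g′(t) ≥ −A·sin(t − t₀)` then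
`g t − g t₀ ≤ −A(1 − cos(t − t₀))`. RH-FREE. -/
theorem sub_le_neg_mul_one_sub_cos_left {g g' : ℝ → ℝ} {a t₀ A : ℝ}
    (hg : ∀ t ∈ Icc a t₀, HasDerivAt g (g' t) t)
    (hbound : ∀ t ∈ Icc a t₀, -A * Real.sin (t - t₀) ≤ g' t) {t : ℝ} (ht : t ∈ Icc a t₀) :
    g t - g t₀ ≤ -A * (1 - Real.cos (t - t₀)) := by
  set G : ℝ → ℝ := fun s => g s + A * (1 - Real.cos (s - t₀)) with hG
  have hGd : ∀ s ∈ Icc a t₀, HasDerivAt G (g' s + A * Real.sin (s - t₀)) s := by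
    intro s hs
    have hc : HasDerivAt (fun s : ℝ => A * (1 - Real.cos (s - t₀))) (A * Real.sin (s - t₀)) s := by
      have h1 : HasDerivAt (fun s : ℝ => Real.cos (s - t₀)) (-Real.sin (s - t₀) * 1) s :=
        ((hasDerivAt_id s).sub_const t₀).cos
      have h2 := (h1.const_sub (1 : ℝ)).const_mul A
      refine h2.congr_deriv ?_
      ring
    exact (hg s hs).add hc
  have hmono : MonotoneOn G (Icc a t₀) := by
    refine monotoneOn_of_deriv_nonneg (convex_Icc a t₀)
      (fun s hs => (hGd s hs).continuousAt.continuousWithinAt)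
      (fun s hs => (hGd s (interior_subset hs)).differentiableAt.differentiableWithinAt) ?_
    intro s hs
    have hs' : s ∈ Icc a t₀ := interior_subset hs
    rw [(hGd s hs').deriv]
    have := hbound s hs'
    linarith
  have ht₀ : t₀ ∈ Icc a t₀ := ⟨ht.1.trans ht.2, le_rfl⟩
  have h := hmono ht ht₀ ht.2
  simp only [hG, sub_self, Real.cos_zero, mul_zero, add_zero] at h
  linarith

/-- **Cosine-descent comparison, two-sided:** on `[a, b] ∋ t₀`, if `g′(t) ≤ −A sin(t−t₀)` for
`t ≥ t₀` and `g′(t) ≥ −A sin(t−t₀)` for `t ≤ t₀`, then `g t − g t₀ ≤ −A(1 − cos(t − t₀))` for every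
`t ∈ [a, b]` — the shape of the global descent (S4)(i) with `A = κ₁(n+1)`. RH-FREE. -/
theorem sub_le_neg_mul_one_sub_cos {g g' : ℝ → ℝ} {a b t₀ A : ℝ} (ht₀ : t₀ ∈ Icc a b)
    (hg : ∀ t ∈ Icc a b, HasDerivAt g (g' t) t)
    (hright : ∀ t ∈ Icc t₀ b, g' t ≤ -A * Real.sin (t - t₀))
    (hleft : ∀ t ∈ Icc a t₀, -A * Real.sin (t - t₀) ≤ g' t) {t : ℝ} (ht : t ∈ Icc a b) :
    g t - g t₀ ≤ -A * (1 - Real.cos (t - t₀)) := by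
  rcases le_total t₀ t with h | h
  · exact sub_le_neg_mul_one_sub_cos_right
      (fun s hs => hg s ⟨ht₀.1.trans hs.1, hs.2⟩) hright ⟨h, ht.2⟩
  · exact sub_le_neg_mul_one_sub_cos_left
      (fun s hs => hg s ⟨hs.1, hs.2.trans ht₀.2⟩) hleft ⟨ht.1, h⟩

end Summit.RiemannHypothesis.RiemannHypothesis.Theorems.JensenPolynomials.LogBandArc
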